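import Summits.BirchSwinnertonDyer.Rank1Residual.P2.TwistInvarianceAtTwo
import Literature.NumberTheory.EllipticCurves.TwoAdicImageSurjectivity
import Literature.NumberTheory.EllipticCurves.IsogenyHasCMIffJMemProofs
import HarnessLib

/-!
# Sub-lane «bsd-p2»: TWIST INVARIANCE OF THE IMAGE AND CM AXES — along any quadratic-twist model
# `C • E.quadraticTwist d = E′` the CM value (`none/split/inert/ramified`) is unchanged
# (unconditionally) and the image value (`surj8/surjNot8/cyclic3/borel`) is unchanged (granted
# Dokchitser–Dokchitser 2012 as typed); a twist family meets only the `2 × 5` cells of ONE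
# (image, CM) column of the `160`-cell grid

HONEST FRAMING (sub-lane «bsd-p2», run/shared/lean/b2b/bsd-rank1-residual/p2/, verbatim in every
file): the target of record is the FULL Birch–Swinnerton-Dyer formula for EVERY analytic-rank `≤ 1`
`E/ℚ` at ALL primes INCLUDING `2`; the odd-prime class ledger is referee A's; the `2`-part is OPEN
(cells O1 = X5 ∖ CM and O12 = the CM corner) and under census by «bsd-p2». Census / instrument
output at `2` = EVIDENCE / conjecture items with held-out validation, NEVER a Literature fact;
certificates close PAIRS (one isogeny class, `p = 2`), never classes. This file asserts NO
arithmetic fact. The CM axis statements are kernel theorems (the tree's THEOREM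
`WeierstrassCurve.hasCM_iff_j_mem_holds`: CM over `ℚ̄` ⟺ `j ∈` the thirteen CM invariants; `j` is
invariant under `ℚ`-isomorphism and quadratic twist; `CMSplit/CMRamified/CMInert` read `j` only).
The image axis statements take ONE named fact as an explicit binder: Dokchitser–Dokchitser 2012 as
typed (`DokchitserDokchitser2012_surjective_mod_two_four_eight`: `ρ̄₂` onto ⟺ no rational `2`-torsion
∧ `Δ ∉ ℚ²`; `ρ̄₄` onto ⟺ `ρ̄₂` onto ∧ `−Δ ∉ ℚ²` ∧ `j ≠ −4t³(t+8)`; `ρ̄₈` onto ⟺ `ρ̄₄` onto ∧ `±2Δ ∉ ℚ²`)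
— every right-hand side is a function of (`j`, `Δ mod ℚ^{×2}`, rational `2`-torsion), and all three
are twist invariants (`Δ(E^{(d)}) = d⁶Δ(E)`, `Δ(C • V) = u⁻¹²Δ(V)`; `P2/TwistInvarianceAtTwo.lean`).
Consequence for mandate (ii)'s twist-family axis (`orbit_id`): a twist orbit varies only in the
rank bit and the reduction value — it lies in one (img, cm) column, `≤ 10` of the `160` cells. The
census's class-wide JOIN of `orbit_id` against `img_E` / `cm` is thereby a CHECK of the instruments,
not a discovery (EVIDENCE vs theorem, said plainly). Nothing booked; no mark moved. Unit
`b2b-bsdres-p2-typer` GEN 2; NEW file (sequel of `TwistInvarianceAtTwo.lean`).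

## Contents

* §1 `j` along a twist model (`j_eq_of_twist`); `IsSquare (c·Δ)` along a twist model for any
  constant `c` (`isSquare_mul_Δ_iff_of_twist`; `c = −1, 2, −2` are Dokchitser–Dokchitser's).
* §2 CM AXIS (unconditional): `hasCM_iff_of_twist`, `cmSplit/cmRamified/cmInert_iff_of_twist`,
  `cmAtTwoOf_eq_of_twist`.
* §3 IMAGE AXIS (granted DD12): `surj_two_iff_of_twist`, `surjMod_four_iff_of_twist`,
  `surjModEight_iff_of_twist`, `imgAtTwoOf_eq_of_twist`.
* §4 THE COLUMN THEOREM `cellAtTwoOf_img_cm_eq_of_twist`: `(cellAtTwoOf E′).img = (cellAtTwoOf E).img`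
  and `.cm = .cm`; the Kriz–Li twists sit in the exact image column of their base.

References: Dokchitser–Dokchitser, Math. Z. 272 (2012) 961–964, Theorem [DokchitserDokchitserMathZ2012];
Silverman *AEC* III.1, X.5, App. C §11 [SilvermanAEC2009]; HOME/p2/typer/TYPING-PLAN.md §2 (axes).
-/

noncomputable section

open scoped Classical

open WeierstrassCurve Literature.NumberTheory.EllipticCurves
  Literature.NumberTheory.EllipticCurves.Rank1Residual
  Literature.NumberTheory.EllipticCurves.Rank1Residual.Typed

set_option autoImplicit false

namespace Summit.BirchSwinnertonDyer.Rank1Residual.P2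

/-! ## §1 `j` and `Δ mod squares` along a twist model -/

section Invariants

variable (V : WeierstrassCurve ℚ) [V.IsElliptic] {d : ℚ} {V' : WeierstrassCurve ℚ} [V'.IsElliptic]

/-- **`j` is constant along a twist model**: `j(C • V.quadraticTwist d) = j(V)` (`d ≠ 0`).
[cite: SilvermanAEC2009, X.5 Cor. 5.4 (iii) and III.1 Prop. 1.4 (b)] -/
theorem j_eq_of_twist (hd : d ≠ 0) (h : ∃ C : VariableChange ℚ, C • V.quadraticTwist d = V') :
    V'.j = V.j := by
  obtain ⟨C, rfl⟩ := h
  haveI := V.isElliptic_quadraticTwist hd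
  rw [variableChange_j, V.j_quadraticTwist hd]

omit [V.IsElliptic] [V'.IsElliptic] in
/-- `c·Δ ∈ ℚ^{×2}·ℚ` is constant along a twist model for every constant `c`: the discriminant
changes by the square `(u⁻⁶d³)²`. [cite: SilvermanAEC2009, III.1 (Δ under (u,r,s,t)) and X.5] -/
theorem isSquare_mul_Δ_iff_of_twist (c : ℚ) (hd : d ≠ 0)
    (h : ∃ C : VariableChange ℚ, C • V.quadraticTwist d = V') :
    IsSquare (c * V.Δ) ↔ IsSquare (c * V'.Δ) := by
  obtain ⟨C, rfl⟩ := h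
  rw [variableChange_Δ, quadraticTwist_Δ]
  have hu : ((C.u⁻¹ : ℚˣ) : ℚ) ≠ 0 := (C.u⁻¹).ne_zero
  have h6 : ((C.u⁻¹ : ℚˣ) : ℚ) ^ 6 * d ^ 3 ≠ 0 := mul_ne_zero (pow_ne_zero 6 hu) (pow_ne_zero 3 hd)
  constructor
  · rintro ⟨r, hr⟩
    refine ⟨((C.u⁻¹ : ℚˣ) : ℚ) ^ 6 * d ^ 3 * r, ?_⟩
    linear_combination (((C.u⁻¹ : ℚˣ) : ℚ) ^ 12 * d ^ 6) * hr
  · rintro ⟨r, hr⟩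
    refine ⟨r / (((C.u⁻¹ : ℚˣ) : ℚ) ^ 6 * d ^ 3), ?_⟩
    field_simp
    linear_combination hr

end Invariants

/-! ## §2 The CM axis is twist-invariant (unconditional) -/

section CM

variable (W : WeierstrassCurve ℚ) [W.IsElliptic] {d : ℚ} {W' : WeierstrassCurve ℚ} [W'.IsElliptic]

/-- **CM is constant along a twist model** (`HasCM` = CM over `ℚ̄` ⟺ `j ∈` the thirteen CM
invariants, the tree's theorem `hasCM_iff_j_mem_holds`; `j` is constant).
[cite: SilvermanAEC2009, App. C §11 (CM j-invariants) and X.5 Cor. 5.4] -/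
theorem hasCM_iff_of_twist (hd : d ≠ 0) (h : ∃ C : VariableChange ℚ, C • W.quadraticTwist d = W') :
    W.HasCM ↔ W'.HasCM := by
  rw [WeierstrassCurve.hasCM_iff_j_mem_holds W, WeierstrassCurve.hasCM_iff_j_mem_holds W',
    j_eq_of_twist W hd h]

/-- `CMRamified · 2` is constant along a twist model (it reads `j` only). [folklore] -/
theorem cmRamified_iff_of_twist (hd : d ≠ 0)
    (h : ∃ C : VariableChange ℚ, C • W.quadraticTwist d = W') :
    CMRamified W 2 ↔ CMRamified W' 2 := by
  unfold CMRamified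
  rw [j_eq_of_twist W hd h]

/-- `CMSplit · 2` is constant along a twist model (it reads `j` only). [folklore] -/
theorem cmSplit_iff_of_twist (hd : d ≠ 0) (h : ∃ C : VariableChange ℚ, C • W.quadraticTwist d = W') :
    CMSplit W 2 ↔ CMSplit W' 2 := by
  unfold CMSplit
  rw [j_eq_of_twist W hd h]

/-- `CMInert · 2` is constant along a twist model. [folklore] -/
theorem cmInert_iff_of_twist (hd : d ≠ 0) (h : ∃ C : VariableChange ℚ, C • W.quadraticTwist d = W') :
    CMInert W 2 ↔ CMInert W' 2 := by
  unfold CMInert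
  rw [cmRamified_iff_of_twist W hd h, cmSplit_iff_of_twist W hd h]

/-- **The CM value of the grid is constant along a twist model** (unconditional).
[cite: SilvermanAEC2009, App. C §11 and X.5 Cor. 5.4] -/
theorem cmAtTwoOf_eq_of_twist (hd : d ≠ 0) (h : ∃ C : VariableChange ℚ, C • W.quadraticTwist d = W') :
    cmAtTwoOf W' = cmAtTwoOf W := by
  unfold cmAtTwoOf
  rw [hasCM_iff_of_twist W hd h, cmSplit_iff_of_twist W hd h, cmRamified_iff_of_twist W hd h]

end CM

/-! ## §3 The image axis is twist-invariant (granted Dokchitser–Dokchitser 2012 as typed) -/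

section Image

variable (W : WeierstrassCurve ℚ) [W.IsElliptic] {d : ℚ} {W' : WeierstrassCurve ℚ} [W'.IsElliptic]

/-- **`ρ̄_{E,2}` onto is constant along a twist model**, granted DD12 (1): onto ⟺ no rational point of
order `2` (`Irr`, twist-invariant by `irr_two_iff_of_twist`) ∧ `Δ ∉ ℚ²` (twist-invariant).
[cite: DokchitserDokchitserMathZ2012, Theorem (1) (p. 961)] -/
theorem surj_two_iff_of_twist (hDD : DokchitserDokchitser2012_surjective_mod_two_four_eight)
    (hd : d ≠ 0) (h : ∃ C : VariableChange ℚ, C • W.quadraticTwist d = W') :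
    Surj W 2 ↔ Surj W' 2 := by
  show W.HasSurjectiveModNGaloisRep 2 ↔ W'.HasSurjectiveModNGaloisRep 2
  rw [(hDD W).1, (hDD W').1, ← X5.O1.irr_two_iff_forall_two_nsmul W,
    ← X5.O1.irr_two_iff_forall_two_nsmul W', irr_two_iff_of_twist W hd h]
  have hΔ := isSquare_mul_Δ_iff_of_twist W 1 hd h
  simp only [one_mul] at hΔ
  rw [hΔ]

/-- **`ρ̄_{E,4}` onto is constant along a twist model**, granted DD12 (1)–(2) (`−Δ ∉ ℚ²` and
`j ≠ −4t³(t+8)` are twist invariants). [cite: DokchitserDokchitserMathZ2012, Theorem (2) (p. 961)] -/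
theorem surjMod_four_iff_of_twist (hDD : DokchitserDokchitser2012_surjective_mod_two_four_eight)
    (hd : d ≠ 0) (h : ∃ C : VariableChange ℚ, C • W.quadraticTwist d = W') :
    W.HasSurjectiveModNGaloisRep 4 ↔ W'.HasSurjectiveModNGaloisRep 4 := by
  rw [(hDD W).2.1, (hDD W').2.1]
  have h2 : W.HasSurjectiveModNGaloisRep 2 ↔ W'.HasSurjectiveModNGaloisRep 2 :=
    surj_two_iff_of_twist W hDD hd h
  have hΔ := isSquare_mul_Δ_iff_of_twist W (-1) hd h
  simp only [neg_one_mul] at hΔ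
  rw [h2, hΔ, j_eq_of_twist W hd h]

/-- **`ρ̄_{E,8}` onto (the grid's `SurjModEight`) is constant along a twist model**, granted DD12
(1)–(3) (`2Δ, −2Δ ∉ ℚ²` are twist invariants). [cite: DokchitserDokchitserMathZ2012, Theorem (3) (p. 961)] -/
theorem surjModEight_iff_of_twist (hDD : DokchitserDokchitser2012_surjective_mod_two_four_eight)
    (hd : d ≠ 0) (h : ∃ C : VariableChange ℚ, C • W.quadraticTwist d = W') :
    X5.O1.SurjModEight W ↔ X5.O1.SurjModEight W' := by
  show W.HasSurjectiveModNGaloisRep 8 ↔ W'.HasSurjectiveModNGaloisRep 8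
  rw [(hDD W).2.2, (hDD W').2.2, surjMod_four_iff_of_twist W hDD hd h,
    isSquare_mul_Δ_iff_of_twist W 2 hd h]
  have hΔ := isSquare_mul_Δ_iff_of_twist W (-2) hd h
  rw [hΔ]

/-- **The image value of the grid is constant along a twist model**, granted DD12.
[cite: DokchitserDokchitserMathZ2012, Theorem (p. 961)] -/
theorem imgAtTwoOf_eq_of_twist (hDD : DokchitserDokchitser2012_surjective_mod_two_four_eight)
    (hd : d ≠ 0) (h : ∃ C : VariableChange ℚ, C • W.quadraticTwist d = W') :
    imgAtTwoOf W' = imgAtTwoOf W := by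
  unfold imgAtTwoOf
  rw [surj_two_iff_of_twist W hDD hd h, surjModEight_iff_of_twist W hDD hd h,
    irr_two_iff_of_twist W hd h]

end Image

/-! ## §4 The column theorem: a twist orbit lies in one (image, CM) column -/

section Column

variable (W : WeierstrassCurve ℚ) [W.IsElliptic] [W.IsGloballyMinimal] {d : ℚ}
  {W' : WeierstrassCurve ℚ} [W'.IsElliptic] [W'.IsGloballyMinimal]

/-- **THE COLUMN THEOREM.** Along a twist model `C • E.quadraticTwist d = E′` (`d ≠ 0`, both models
globally minimal), the cells of `E` and `E′` have the SAME image value (granted DD12) and the SAME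
CM value (unconditionally): a twist orbit (census axis `orbit_id`) varies only in the rank bit and
the reduction value — at most `2 × 5 = 10` of the `160` cells, one (img, cm) column. The census's
JOIN of `orbit_id` against `img_E` / `cm` is a CHECK of the instruments against this theorem.
[cite: DokchitserDokchitserMathZ2012, Theorem (p. 961)] [cite: SilvermanAEC2009, X.5 Cor. 5.4] -/
theorem cellAtTwoOf_img_cm_eq_of_twist
    (hDD : DokchitserDokchitser2012_surjective_mod_two_four_eight) (hd : d ≠ 0)
    (h : ∃ C : VariableChange ℚ, C • W.quadraticTwist d = W') :
    (cellAtTwoOf W').img = (cellAtTwoOf W).img ∧ (cellAtTwoOf W').cm = (cellAtTwoOf W).cm :=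
  ⟨imgAtTwoOf_eq_of_twist W hDD hd h, cmAtTwoOf_eq_of_twist W hd h⟩

omit [W.IsGloballyMinimal] [W'.IsGloballyMinimal] in
/-- The CM half alone, with no named fact. [cite: SilvermanAEC2009, App. C §11 and X.5 Cor. 5.4] -/
theorem cellAtTwoOf_cm_eq_of_twist [W.IsGloballyMinimal] [W'.IsGloballyMinimal] (hd : d ≠ 0)
    (h : ∃ C : VariableChange ℚ, C • W.quadraticTwist d = W') :
    (cellAtTwoOf W').cm = (cellAtTwoOf W).cm :=
  cmAtTwoOf_eq_of_twist W hd h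

omit [W.IsGloballyMinimal] [W'.IsGloballyMinimal] in
/-- A non-CM base has a non-CM twist orbit: the O1 / O12 boundary is never crossed by twisting.
[cite: SilvermanAEC2009, App. C §11] -/
theorem not_hasCM_of_twist (hcm : ¬ W.HasCM) (hd : d ≠ 0)
    (h : ∃ C : VariableChange ℚ, C • W.quadraticTwist d = W') : ¬ W'.HasCM :=
  fun h' => hcm ((hasCM_iff_of_twist W hd h).mpr h')

variable {W} [NeZero (W.conductorNorm ℤ)]

omit [W.IsGloballyMinimal] [NeZero (W.conductorNorm ℤ)] in
/-- **The Kriz–Li twists sit in the exact image column of their base** (granted DD12): for a model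
`W₁` of `E^{(d)}` (`d ≠ 0`), `(cellAtTwoOf W₁).img = (cellAtTwoOf W).img` — so a certified base in
`surj8` (resp. `surjNot8`, `cyclic3`) transports only into `surj8` (resp. `surjNot8`, `cyclic3`)
cells. [cite: DokchitserDokchitserMathZ2012, Theorem (p. 961)] [cite: KrizLi2019, Thm. 5.1 setting] -/
theorem img_eq_of_krizLi_twist [W.IsGloballyMinimal]
    (hDD : DokchitserDokchitser2012_surjective_mod_two_four_eight) {d : ℤ} (hd : d ≠ 0)
    {W₁ : WeierstrassCurve ℚ} [W₁.IsElliptic] [W₁.IsGloballyMinimal]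
    (hW₁ : ∃ C : VariableChange ℚ, C • W.quadraticTwist (d : ℚ) = W₁) :
    (cellAtTwoOf W₁).img = (cellAtTwoOf W).img :=
  imgAtTwoOf_eq_of_twist W hDD (by exact_mod_cast hd) hW₁

end Column

end Summit.BirchSwinnertonDyer.Rank1Residual.P2

end
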